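import Summits.BirchSwinnertonDyer.Rank1Residual.PrintX8.CertificateSchema
import HarnessLib

/-!
# Leaf X8 (`p = 3` good supersingular, `a_3 = ±3`), print-tier cell `bsd-print-x8` — Mazur–Tate LAYER certificates of the
# small-image cells: the record schema (one `MTLayer` = the element `θ_n(E, T)` of ONE cell at ONE layer `n`, its exact
# coefficients on two engines, `μ(θ_n) = 0`, `λ(θ_n)`) and its in-kernel recheck

HONEST FRAMING (cell `bsd-print-x8`, run/shared/lean/pub/bsd-print-x8/, D-0131 (2) PRINT TIER, typer seat ty3; leaf
`Rank1Residual.ClassX8 W p := p = 3 ∧ GoodSS W 3 ∧ a_3 ≠ 0` of `CornersAll` §1b): the leaf counts only when its CLASS THEOREM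
is in the kernel BY NAME, flag-free (PARTITION currency, D-0132). This file books nothing, is not a class theorem, introduces
no named fact and asserts nothing about elliptic curves. It fixes the FORMAT in which the finite Mazur–Tate data of the 61
SMALL-IMAGE census cells of the leaf (`ρ̄_{E,3}` not onto, image the normaliser of the non-split Cartan; the K3-census
instances of the class of route `PrintX8`'s crux `SharpFlatMuAnSmallImageX8`, item stmt-BirchSwinnertonDyer-20714, the
analytic rider «`L^•_3(E) ≠ 0 ⇒ μ(L^•) = 0`» = Perrin-Riou 2003 Conj. 7.1 on that family) enter the tree as DATA, one
`MTLayer` per cell and layer, in the sibling files `CertificateMazurTateRecords*.lean` (each states `CertifiedMT [r₁, …]`,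
proved by `decide +kernel`). The CONSUMER is p3's reading lemma
`Theorems/PrintX8MazurTateMuRider.lean` (p546221): ONE certified layer `(Θ ∈ Λ, ι Θ = θ_n(f₀), Θ ≠ 0, μ(Θ) = 0)` of some
parity gives a colour `•` (`♯` ↔ odd `n`, `♭` ↔ even `n`) with `L^• ≠ 0 ∧ μ(L^•) = 0 ∧` unit content; an odd AND an even
layer give `Supersingular.SignedMuVanishing W 3` AT THE PAIR (`ClassX8.signedMuVanishing_of_mazurTate_odd_even`). Exactly as
the cell `b2b-bsdres` / `bsd-ssimc` Mazur–Tate records (`Supersingular/MazurTateRecords{,BW}.lean`, schema `MTRow`/`MTRowBW`;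
`Theorems/SignedLowerHalvesKobayashiLowerHalfLargeImageMazurTateRecords*.lean`) those DATA binders `hΘ0 : Θ ≠ 0`,
`hμ : mu Θ = 0` of a per-cell witness theorem are discharged MODULO THE TWO ENGINES by a row of this schema; per-cell
witnesses are BC5 witnesses / `--supports` of the class-wide item 20714, they close nothing (the item quantifies over an
infinite class; PLAN v1.3 wording rule).

## What an `MTLayer` records

For the cell `label` (Cremona curve 1 of its class, reduced minimal model `ainvs`, conductor `N`, `3 ∤ N`, `a_3 = a3 = ±3`,
analytic rank `rank ≤ 1`) and the layer `n = layer ≥ 0`, in the TREE'S convention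
(`Literature.NumberTheory.EllipticCurves.mazurTateElement f₀ 3 n`, Pollack 2003 Def. 6.15: variable `1 + T ↔ γ = 4`,
Teichmüller representatives `±1`, representatives of `(ℤ/3^{n+1})^×` in `[0, 3^{n+1})`):
`θ_n(E, T) = ∑_{s=0}^{3ⁿ−1} m_s (1+T)^s`, `m_s = [4^s/3^{n+1}]⁺ + [−4^s/3^{n+1}]⁺ = 2·[4^s/3^{n+1}]⁺`,
`[r]⁺ = Re(({∞,r}_f + {∞,−r}_f)/2)/Ω`, `{∞,r}_f = 2πi∫_{i∞}^r f` (so `[0]⁺ = L(E,1)/Ω`), displayed EXACTLY as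
`m_s = coeffs[s] / den` (integers `coeffs`, ONE denominator `den` with `3 ∤ den`). Two engines computed every `m_s` and
agree on all of them (kit job ids in `engines`): ENGINE A (this seat, `HOME/ty3/jobs/jobMT/enginea.gp`, PARI `ellan`/
periods, the Atkin–Lehner two-height formula `[a/m]⁺ = (Re S_Y(a/m) − λ_N Re S_U(−w/m))/Ω`, `Y·U = 1/(N m²)`, run at TWO
height splittings that agree exactly, exact Hecke relations between all levels `3^k`, `k ≤ n+1`, `±`-symmetry, and the
resultant check below) and ENGINE B (cell `b2b-bsdres`, unit iw-2, PARI-free python `msengine` — sha256-pinned, re-run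
unmodified with coefficient dumps; its archived `SS-SUPPORT-500K` deep-pass rows `runs/gen7/j095…|j0974…|j1034…` carry the
same `(μ, λ, D, θ_n(0))` per layer = the census's «61/61 cells `μ(θ_4) = μ(θ_5) = 0`», evidence #4 on item 20622).
PERIOD: `Ω` = Néron real period of `ainvs` INCLUDING the number of real components; this is the tree's `Ω⁺_{f₀}` EXACTLY
when the curve is the `Γ₀(N)`-optimal curve of its class with Manin constant `1` (Cremona: curve 1; `c = 1` verified in the
range of the tables), and in any case `Ω/Ω⁺_{f₀} ∈ ℤ_{(3)}^×` on the leaf (`3² ∤ 4N` ⇒ `3 ∤ c`, Mazur 1978; `E[3]`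
irreducible ⇒ no `3`-isogeny) — `Θ ≠ 0`, `μ(Θ) = 0`, `λ(Θ)` and unit content are insensitive to such a factor.
Fields: `mu = μ(θ_n)` (`= v_3` of the content; both engines), `lam = λ(θ_n)` (index of the first `3`-adic unit among the
`T`-ADIC coefficients; both engines), `q = deg ω_n^+` (`n` odd) / `deg ω_n^-` (`n` even), `lamL = λ(θ_n) − q` (the
reading `λ(L^•)` of `MazurTateLambdaReading` / `MTRow`), `unitIndex` = the first `s` with `3 ∤ coeffs[s]`, `vNorm =
v_3(N_{ℚ(ζ_{3ⁿ})/ℚ} θ_n(ζ_{3ⁿ} − 1))` (engine A, exact resultant `Res(Φ_{3ⁿ}(U), ∑ m_s U^s)`; the tree theorem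
`Iwasawa/LambdaInvariantValuationTwisted`: `vNorm < φ(3ⁿ)` ⇒ `μ(θ_n) = 0 ∧ λ(θ_n) = vNorm`), `tableDen` = lcm of the
denominators of the whole level-`3^{n+1}` table `([b/3^{n+1}]⁺)_b` (both engines), `x0Num/x0Den = [0]⁺ = L(E,1)/Ω` as
the CELL'S RECORD has it (`#Ш_an·∏c_q/#E(ℚ)_tors²` for rank `0`, `PrintX8/CertificateRecords*.lean`, engines T ‖ P; `0` for
rank `1`).

## What the kernel rechecks (`MTLayer.check`)

* the leaf bits: `ainvs.length = 5`, `3 ∤ N`, `3 ∤ Δ(ainvs)`, `a3 = a_3` RECOMPUTED by point counting, `a3 = ±3`, `rank ≤ 1`,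
  `rank = 1 ↔ x0Num = 0`;
* shape: `coeffs.length = 3ⁿ`, `0 < den`, `3 ∤ den`, `den ∣ tableDen`, `odd ↔ n` odd, `4q + (3 | 1) = 3ⁿ`;
* **`μ(θ_n) = 0` ON THE DISPLAYED VECTOR**: `3 ∣ coeffs[s]` for `s < unitIndex` and `3 ∤ coeffs[unitIndex]` (so the content
  of `θ_n` is a `3`-adic unit: `θ_n ≠ 0` and `μ(θ_n) = 0` — the two DATA binders of the consumer), and `mu = 0`;
* **`λ(θ_n)` ON THE DISPLAYED VECTOR**: the `T`-adic coefficients of `∑_s coeffs[s]·(1+T)^s` modulo `3` are RECOMPUTED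
  (Horner, `sigmaToTMod3`) and the index of the first non-zero one is `lam`; `lam = q + lamL < 3ⁿ`;
* the norm certificate: `n = 0`, or `vNorm ≥ φ(3ⁿ)`, or `vNorm = lam`;
* **the Hecke-sum identity tying `θ_n` to the cell's BSD record**: `θ_n(0) = ∑_s m_s = ∑_{a ∈ (ℤ/3^{n+1})^×}[a/3^{n+1}]⁺
  = (S_{n+1} − S_n)·[0]⁺` with `S_0 = 1`, `S_1 = a_3 − 1`, `S_{k+2} = a_3 S_{k+1} − 3 S_k` (from `a_p[r]⁺ = ∑_u[(r+u)/p]⁺ +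
  [pr]⁺`), checked as `(∑ coeffs)·x0Den = (S_{n+1} − S_n)·x0Num·den` — a THIRD, independent source (Cremona/PARI
  `L(E,1)/Ω`) agreeing with the modular-symbol engines.
NOT checked here (CLAIMS, modulo the two engines): that `ainvs` is Cremona's curve `label`, that `(1/den)∑ coeffs[s](1+T)^s`
IS `θ_n` of that curve in the convention above, the values `tableDen`, `vNorm`, and the engines' agreement itself.

Design: plain computable data, naive arithmetic, `decide +kernel`; no instance, no axiom, no `sorry`. Data + generator:
`HOME/ty3/data/x8_mt61.json`, `HOME/ty3/jobs/jobMT/`, `HOME/ty3/scripts/gen_mt_records.py`. References: [Pollack2003] Def.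
6.15, Prop. 6.9–6.10; [MazurTateTeitelbaum1986Invent] §I.4 (4.2), §I.8; [Cremona1997] §2.8, §2.10; [SteinWuthrich2013] §3;
[PerrinRiou2003] §7 (Conj. 7.1; `µ₀, µ₁ > 0`, `µ_n = 0` for `n ≥ 3` on `a_3 = ±3` examples); [Sprung2017] §3.
-/

namespace Summit.BirchSwinnertonDyer.Rank1Residual.PrintX8

open Literature.NumberTheory.EllipticCurves.Rank1Residual.X11RankOneCertificates (discOf apNaive)

/-- One Mazur–Tate layer certificate of a small-image census cell of class X8 at `p = 3` (module docstring): the cell,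
the layer `n`, the exact coefficients `m_s = coeffs[s]/den` of `θ_n = ∑_{s<3ⁿ} m_s (1+T)^s`, the two-engine readings
`μ(θ_n) = 0`, `λ(θ_n)`, and bookkeeping. Asserts nothing; `MTLayer.check` is its decidable recheck. [folklore] -/
structure MTLayer where
  /-- Cremona label (curve 1 of its class). -/
  label : String
  /-- a-invariants `[a₁, a₂, a₃, a₄, a₆]` of the reduced minimal model. -/
  ainvs : List ℤ
  /-- the conductor `N` (`3 ∤ N`). -/
  conductor : ℕ
  /-- `a_3 ∈ {3, −3}`. -/
  a3 : ℤ
  /-- analytic rank (`0` or `1`). -/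
  rank : ℕ
  /-- numerator of `[0]⁺ = L(E,1)/Ω` as recorded by the cell's `Record` (`#Ш_an·∏c_q` for rank `0`; `0` for rank `1`). -/
  x0Num : ℤ
  /-- denominator of `[0]⁺` (`#E(ℚ)_tors²` for rank `0`; `1` for rank `1`). -/
  x0Den : ℕ
  /-- the layer `n ≥ 0` (`θ_n ∈ ℚ[T]`, degree `< 3ⁿ`, from the symbols of level `3^{n+1}`). -/
  layer : ℕ
  /-- parity of `n`: `true` = odd (colour `♯`), `false` = even (colour `♭`). -/
  odd : Bool
  /-- the common denominator `den ≥ 1`, `3 ∤ den`, of the displayed coefficients. -/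
  den : ℕ
  /-- `coeffs[s] = den·m_s`, `s = 0, …, 3ⁿ − 1`, with `θ_n = ∑_s m_s (1+T)^s`. -/
  coeffs : List ℤ
  /-- the first `s` with `3 ∤ coeffs[s]`. -/
  unitIndex : ℕ
  /-- `μ(θ_n)` (both engines). -/
  mu : ℕ
  /-- `λ(θ_n)`: index of the first `3`-adic unit among the `T`-adic coefficients (both engines; rechecked mod `3`). -/
  lam : ℕ
  /-- `q = deg ω_n^+ = (3ⁿ − 3)/4` (`n` odd) resp. `deg ω_n^- = (3ⁿ − 1)/4` (`n` even). -/
  q : ℕ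
  /-- `λ(θ_n) − q` (the reading `λ(L^♯)` for odd `n`, `λ(L^♭)` for even `n`, when in the faithful range). -/
  lamL : ℕ
  /-- `v_3(N_{ℚ(ζ_{3ⁿ})/ℚ} θ_n(ζ_{3ⁿ} − 1))` (engine A; `0` at `n = 0`). -/
  vNorm : ℕ
  /-- lcm of the denominators of the level-`3^{n+1}` plus-symbol table (both engines). -/
  tableDen : ℕ
  /-- provenance strings (engines, kit job ids); documentation only. -/
  engines : List String

/-! ### Kernel-evaluable helpers -/

/-- `S_k` with `S_0 = 1`, `S_1 = a_3 − 1`, `S_{k+2} = a_3·S_{k+1} − 3·S_k`: by the Hecke relation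
`a_p[r]⁺ = ∑_{u mod p}[(r+u)/p]⁺ + [pr]⁺` one has `∑_{b mod 3^k}[b/3^k]⁺ = S_k·[0]⁺`, hence
`θ_n(0) = ∑_{3 ∤ a}[a/3^{n+1}]⁺ = (S_{n+1} − S_n)·[0]⁺`. [cite: MazurTateTeitelbaum1986Invent, §I.4 (4.2)] -/
def heckeSum (a3 : ℤ) : ℕ → ℤ
  | 0 => 1
  | 1 => a3 - 1
  | k + 2 => a3 * heckeSum a3 (k + 1) - 3 * heckeSum a3 k

/-- Multiply a coefficient list modulo `3` (constant term first) by `1 + T`. [folklore] -/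
def mulOnePlusTMod3 (a : List ℕ) : List ℕ :=
  List.zipWith (fun x y => (x + y) % 3) (a ++ [0]) (0 :: a)

/-- Add the constant `c mod 3` to a coefficient list modulo `3`. [folklore] -/
def addConstMod3 (c : ℤ) : List ℕ → List ℕ
  | [] => [(c % 3).toNat]
  | x :: xs => ((x + (c % 3).toNat) % 3) :: xs

/-- The `T`-adic coefficients modulo `3` (constant term first, possibly with trailing zeros) of
`∑_s c_s (1+T)^s`, by Horner's rule `c_0 + (1+T)(c_1 + (1+T)(c_2 + ⋯))`. [folklore] -/
def sigmaToTMod3 (c : List ℤ) : List ℕ :=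
  c.foldr (fun cs acc => addConstMod3 cs (mulOnePlusTMod3 acc)) []

/-- Index of the first entry not divisible by `3` (the length if there is none). [folklore] -/
def firstUnitIndex (l : List ℕ) : ℕ := l.findIdx fun x => x % 3 != 0

namespace MTLayer

variable (r : MTLayer)

/-- Leaf and cell bits: five a-invariants, `3 ∤ N`, `3 ∤ Δ`, `a3 = a_3` by point count, `a_3 = ±3`, `rank ≤ 1`,
`[0]⁺ = 0 ↔ rank = 1`, `0 < x0Den`. [folklore] -/
def checkCell : Bool :=
  (r.ainvs.length == 5) && decide (r.conductor % 3 ≠ 0) && decide (discOf r.ainvs % 3 ≠ 0) &&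
  (apNaive r.ainvs 3 == r.a3) && (r.a3 == 3 || r.a3 == -3) && decide (r.rank ≤ 1) && decide (0 < r.x0Den) &&
  ((r.rank == 1) == (r.x0Num == 0)) && (r.rank == 1 || decide (0 < r.x0Num))

/-- Shape of the layer datum: `3ⁿ` coefficients, `0 < den`, `3 ∤ den`, `den ∣ tableDen`, parity bit, `4q + (3 | 1) = 3ⁿ`. [folklore] -/
def checkShape : Bool :=
  (r.coeffs.length == 3 ^ r.layer) && decide (0 < r.den) && decide (r.den % 3 ≠ 0) && decide (0 < r.tableDen) &&
  (r.tableDen % r.den == 0) && (r.odd == (r.layer % 2 == 1)) &&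
  (4 * r.q + (if r.odd then 3 else 1) == 3 ^ r.layer)

/-- `μ(θ_n) = 0` on the displayed vector: `3 ∣ coeffs[s]` for `s < unitIndex`, `3 ∤ coeffs[unitIndex]`; `mu = 0`. [folklore] -/
def checkMu : Bool :=
  decide (r.unitIndex < r.coeffs.length) && (r.coeffs.take r.unitIndex).all (fun c => c % 3 == 0) &&
  (r.coeffs.getD r.unitIndex 0 % 3 != 0) && (r.mu == 0)

/-- `λ(θ_n)` on the displayed vector: first `T`-adic coefficient `≢ 0 (mod 3)` at index `lam`; `lam = q + lamL < 3ⁿ`;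
norm certificate `vNorm = lam` unless `n = 0` or `vNorm ≥ φ(3ⁿ)`. [cite: Pollack2003, Prop. 6.9 and Prop. 6.10] -/
def checkLam : Bool :=
  (firstUnitIndex (sigmaToTMod3 r.coeffs) == r.lam) && (r.lam == r.q + r.lamL) && decide (r.lam < 3 ^ r.layer) &&
  ((r.layer == 0) || decide (2 * 3 ^ (r.layer - 1) ≤ r.vNorm) || (r.vNorm == r.lam))

/-- The Hecke-sum identity `θ_n(0)·x0Den·… = (S_{n+1} − S_n)·[0]⁺`: `(∑ coeffs)·x0Den = (S_{n+1} − S_n)·x0Num·den`.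
[cite: MazurTateTeitelbaum1986Invent, §I.4 (4.2)] -/
def checkTheta0 : Bool :=
  r.coeffs.sum * (r.x0Den : ℤ) == (heckeSum r.a3 (r.layer + 1) - heckeSum r.a3 r.layer) * r.x0Num * (r.den : ℤ)

/-- The full recheck of a layer record. [folklore] -/
def check : Bool := r.checkCell && r.checkShape && r.checkMu && r.checkLam && r.checkTheta0

end MTLayer

/-- A list of layer records is `CertifiedMT` when every one passes `MTLayer.check`: the statement of each data theorem
`theorem certifiedMT… : CertifiedMT [ … ] := by decide +kernel` of the files `CertificateMazurTateRecords*.lean`. [folklore] -/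
abbrev CertifiedMT (rs : List MTLayer) : Prop := rs.all MTLayer.check = true

/-- Unpacking `CertifiedMT`: every listed record passes the recheck. [folklore] -/
theorem CertifiedMT.check_of_mem {rs : List MTLayer} (h : CertifiedMT rs) {r : MTLayer} (hr : r ∈ rs) :
    r.check = true :=
  List.all_eq_true.1 h r hr

/-- Projections of a passing recheck. [folklore] -/
theorem MTLayer.checks_of_check (r : MTLayer) (h : r.check = true) :
    r.checkCell = true ∧ r.checkShape = true ∧ r.checkMu = true ∧ r.checkLam = true ∧ r.checkTheta0 = true := by
  simp only [MTLayer.check, Bool.and_eq_true] at h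
  exact ⟨h.1.1.1.1, h.1.1.1.2, h.1.1.2, h.1.2, h.2⟩

/-- A passing record is on the leaf: `a3 = 3 ∨ a3 = −3`, `3 ∤ conductor`, `rank ≤ 1`. [folklore] -/
theorem MTLayer.leaf_of_check (r : MTLayer) (h : r.check = true) :
    (r.a3 = 3 ∨ r.a3 = -3) ∧ ¬ 3 ∣ r.conductor ∧ r.rank ≤ 1 := by
  obtain ⟨hc, -, -, -, -⟩ := r.checks_of_check h
  simp only [MTLayer.checkCell, Bool.and_eq_true, decide_eq_true_eq, Bool.or_eq_true, beq_iff_eq] at hc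
  exact ⟨hc.1.1.1.1.2, by omega, hc.1.1.1.2⟩

/-- A passing record has `3ⁿ` coefficients over a denominator prime to `3`, `mu = 0` and `lam = q + lamL < 3ⁿ`. [folklore] -/
theorem MTLayer.shape_of_check (r : MTLayer) (h : r.check = true) :
    r.coeffs.length = 3 ^ r.layer ∧ ¬ 3 ∣ r.den ∧ r.mu = 0 ∧ r.lam = r.q + r.lamL ∧ r.lam < 3 ^ r.layer := by
  obtain ⟨-, hs, hm, hl, -⟩ := r.checks_of_check h
  simp only [MTLayer.checkShape, Bool.and_eq_true, decide_eq_true_eq, beq_iff_eq] at hs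
  simp only [MTLayer.checkMu, Bool.and_eq_true, beq_iff_eq] at hm
  simp only [MTLayer.checkLam, Bool.and_eq_true, decide_eq_true_eq, beq_iff_eq] at hl
  exact ⟨hs.1.1.1.1.1.1, by omega, hm.2, hl.1.1.2, hl.1.2⟩

/-- **The `μ = 0` witness of a passing record**: the displayed coefficient `coeffs[unitIndex]` is not divisible by `3`
(with `3 ∤ den`: the content of the displayed `θ_n` is a `3`-adic unit, i.e. `θ_n ≠ 0` and `μ(θ_n) = 0` — the DATA
binders `hΘ0`, `hμ` of `PrintX8MazurTateMuRider.ClassX8.signedMuVanishing_of_mazurTate_odd_even`, modulo the claim that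
the displayed vector is `θ_n`). [folklore] -/
theorem MTLayer.exists_coeff_not_dvd_of_check (r : MTLayer) (h : r.check = true) :
    r.unitIndex < r.coeffs.length ∧ ¬ (3 : ℤ) ∣ r.coeffs.getD r.unitIndex 0 := by
  obtain ⟨-, -, hm, -, -⟩ := r.checks_of_check h
  simp only [MTLayer.checkMu, Bool.and_eq_true, decide_eq_true_eq, bne_iff_ne, ne_eq, beq_iff_eq] at hm
  exact ⟨hm.1.1.1, fun hd => hm.1.2 (Int.emod_eq_zero_of_dvd hd)⟩

/-- Parity of a passing record: `odd = true ↔ n % 2 = 1` (colour `♯` ↔ odd layer, `♭` ↔ even layer). [folklore] -/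
theorem MTLayer.odd_iff_of_check (r : MTLayer) (h : r.check = true) : (r.odd = true ↔ r.layer % 2 = 1) := by
  obtain ⟨-, hs, -, -, -⟩ := r.checks_of_check h
  simp only [MTLayer.checkShape, Bool.and_eq_true, decide_eq_true_eq, beq_iff_eq] at hs
  have hp : r.odd = (r.layer % 2 == 1) := hs.1.2
  rw [hp]
  exact beq_iff_eq

/-- **Sample (the two unit cells of the leaf at layer `0`, where `θ_0 = m_0 = [1/3]⁺ + [2/3]⁺ = (a_3 − 2)·L(E,1)/Ω` is read
off the cell's record alone), CERTIFIED** — `135200bx1` (`a_3 = −3`, `[0]⁺ = 2`, `θ_0 = −10`) and `442225bz1`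
(`a_3 = −3`, `[0]⁺ = 8`, `θ_0 = −40`): `μ(θ_0) = 0`, `λ(θ_0) = 0` (colour `♭`; the unit case
`ClassX8.signedMuVanishing_of_padicValRat_ratPlusSymbol_eq_zero` of p1 g2). The data files carry layers `4` and `5` of all
61 cells. [folklore] -/
theorem certifiedMT_sample : CertifiedMT [
  { label := "135200bx1", ainvs := [0, 0, 0, -384475, 92823250], conductor := 135200, a3 := -3, rank := 0, x0Num := 2,
    x0Den := 1, layer := 0, odd := false, den := 1, coeffs := [-10], unitIndex := 0, mu := 0, lam := 0, q := 0, lamL := 0,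
    vNorm := 0, tableDen := 1, engines := ["record:CertificateRecordsR0AddNnA", "Barchive:j095731"] },
  { label := "442225bz1", ainvs := [1, -1, 0, -555075292, 5039551552741], conductor := 442225, a3 := -3, rank := 0, x0Num := 8,
    x0Den := 1, layer := 0, odd := false, den := 1, coeffs := [-40], unitIndex := 0, mu := 0, lam := 0, q := 0, lamL := 0,
    vNorm := 0, tableDen := 1, engines := ["record:CertificateRecordsR0AddNnB", "Barchive:j095726"] }] := by
  decide +kernel

end Summit.BirchSwinnertonDyer.Rank1Residual.PrintX8
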